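import Literature.Geometry.Lorentzian.CoordHodgeStar
import Mathlib.LinearAlgebra.Determinant
import HarnessLib

/-!
# Evaluation of component fields on orthonormal frames: multilinear arrays, the volume form
# and the Hodge star

Rank-generic coordinate tensor calculus (`CoordTensorCalculus.lean`, `CoordTensorNorm.lean`,
`CoordVolumeForm.lean`, `CoordHodgeStar.lean`): components are taken in a FIXED basis `b` of the
model space, while pointwise quantities are read in a `G_x`-orthonormal frame `e` through the
multilinear evaluation `frameComp b T₀ (e ∘ K)` and Parseval (`tinner_eq_sum_frame`). Here:

* `frameComp_multilinear` — if the components are those of a multilinear form `F`,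
  `T_I = F(b_{I})`, then `frameComp b T (v) = F(v)` (multilinear expansion; O'Neill 1983, Ch. 2,
  Lemma 2.3 ff.); `MultilinearMap.ofFin4` builds the multilinear form from a function of four
  vectors linear in each slot, and `frameComp_option` reduces `5`-slot arrays to their slices;
* **the volume form is the metric volume form**: `volForm G b y I = √det g_b(y) · b.det (b ∘ I)`
  (`volForm_eq`), `frameComp b (volForm G b y) v = √det g_b(y) · b.det v`, and on a POSITIVELY
  ORIENTED `G_y`-ORTHONORMAL basis `e` (`0 < b.det e`), `frameComp b (volForm G b y) (e ∘ K) = sgnDet K`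
  (`frameComp_volForm_of_orthonormal`: `det g_b = (e.det b)²`, `b.det e · e.det b = 1`; O'Neill 1983,
  Ch. 7, Lemma 7.19: `ω(e₁,…,eₙ) = ±1` on orthonormal frames);
* **the Hodge star on frames**: if `T_I(y) = F(b_I)` for a multilinear `F`, then
  `frameComp b (⋆T (y)) (e ∘ K) = ½ Σ_{d,c} sgnDet(K₀,K₁,d,c) F(e_d, e_c, e_{K₂}, e_{K₃})`
  (`frameComp_star0_of_orthonormal`) — the orthonormal-frame formula `(⋆T)_{ijkl} = T_{i'j'kl}`
  behind `CurvComp.star` (Besse 1987, 1.51; Gursky–LeBrun 1999, §2 (deco)).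

Everything is proved; the only definition is the constructor `MultilinearMap.ofFin4`.

## References

* B. O'Neill, *Semi-Riemannian geometry*, Academic Press 1983, Ch. 2, Lemma 2.3, 2.25 ff.;
  Ch. 7, Def. 7.18–Lemma 7.19. [ONeill1983]
* A. L. Besse, *Einstein manifolds*, Springer 1987, 1.51. [Besse1987]
* M. J. Gursky, C. LeBrun, Ann. Global Anal. Geom. 17 (1999) 315–328, §2 (deco). [GurskyLebrun1999]
-/

noncomputable section

open Set Filter Module Function
open scoped Topology ContDiff Matrix

/-! ### A function of four vectors, linear in each slot, as a multilinear map -/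

namespace MultilinearMap

variable {E : Type*} [AddCommGroup E] [Module ℝ E]

/-- A function of four vectors which is linear in each slot, as a multilinear map on `Fin 4`
(a deliberate extension of Mathlib's `MultilinearMap` namespace by a constructor). [folklore] -/
def ofFin4 (F : E → E → E → E → ℝ) (h0 : ∀ v1 v2 v3, IsLinearMap ℝ fun u ↦ F u v1 v2 v3)
    (h1 : ∀ v0 v2 v3, IsLinearMap ℝ fun u ↦ F v0 u v2 v3)
    (h2 : ∀ v0 v1 v3, IsLinearMap ℝ fun u ↦ F v0 v1 u v3)
    (h3 : ∀ v0 v1 v2, IsLinearMap ℝ fun u ↦ F v0 v1 v2 u) :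
    MultilinearMap ℝ (fun _ : Fin 4 ↦ E) ℝ where
  toFun v := F (v 0) (v 1) (v 2) (v 3)
  map_update_add' := by
    have n10 : (1 : Fin 4) ≠ 0 := by decide
    have n20 : (2 : Fin 4) ≠ 0 := by decide
    have n30 : (3 : Fin 4) ≠ 0 := by decide
    have n01 : (0 : Fin 4) ≠ 1 := by decide
    have n21 : (2 : Fin 4) ≠ 1 := by decide
    have n31 : (3 : Fin 4) ≠ 1 := by decide
    have n02 : (0 : Fin 4) ≠ 2 := by decide
    have n12 : (1 : Fin 4) ≠ 2 := by decide
    have n32 : (3 : Fin 4) ≠ 2 := by decide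
    have n03 : (0 : Fin 4) ≠ 3 := by decide
    have n13 : (1 : Fin 4) ≠ 3 := by decide
    have n23 : (2 : Fin 4) ≠ 3 := by decide
    intro _ v i x y
    fin_cases i
    · simp only [Fin.zero_eta, Fin.isValue, update_self, ne_eq, n10, not_false_eq_true,
        update_of_ne, n20, n30]
      exact (h0 _ _ _).map_add x y
    · simp only [Fin.mk_one, Fin.isValue, update_self, ne_eq, n01, not_false_eq_true,
        update_of_ne, n21, n31]
      exact (h1 _ _ _).map_add x y
    · simp only [Fin.reduceFinMk, Fin.isValue, update_self, ne_eq, n02, not_false_eq_true,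
        update_of_ne, n12, n32]
      exact (h2 _ _ _).map_add x y
    · simp only [Fin.reduceFinMk, Fin.isValue, update_self, ne_eq, n03, not_false_eq_true,
        update_of_ne, n13, n23]
      exact (h3 _ _ _).map_add x y
  map_update_smul' := by
    have n10 : (1 : Fin 4) ≠ 0 := by decide
    have n20 : (2 : Fin 4) ≠ 0 := by decide
    have n30 : (3 : Fin 4) ≠ 0 := by decide
    have n01 : (0 : Fin 4) ≠ 1 := by decide
    have n21 : (2 : Fin 4) ≠ 1 := by decide
    have n31 : (3 : Fin 4) ≠ 1 := by decide
    have n02 : (0 : Fin 4) ≠ 2 := by decide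
    have n12 : (1 : Fin 4) ≠ 2 := by decide
    have n32 : (3 : Fin 4) ≠ 2 := by decide
    have n03 : (0 : Fin 4) ≠ 3 := by decide
    have n13 : (1 : Fin 4) ≠ 3 := by decide
    have n23 : (2 : Fin 4) ≠ 3 := by decide
    intro _ v i c x
    fin_cases i
    · simp only [Fin.zero_eta, Fin.isValue, update_self, ne_eq, n10, not_false_eq_true,
        update_of_ne, n20, n30, smul_eq_mul]
      exact (h0 _ _ _).map_smul c x
    · simp only [Fin.mk_one, Fin.isValue, update_self, ne_eq, n01, not_false_eq_true,
        update_of_ne, n21, n31, smul_eq_mul]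
      exact (h1 _ _ _).map_smul c x
    · simp only [Fin.reduceFinMk, Fin.isValue, update_self, ne_eq, n02, not_false_eq_true,
        update_of_ne, n12, n32, smul_eq_mul]
      exact (h2 _ _ _).map_smul c x
    · simp only [Fin.reduceFinMk, Fin.isValue, update_self, ne_eq, n03, not_false_eq_true,
        update_of_ne, n13, n23, smul_eq_mul]
      exact (h3 _ _ _).map_smul c x

/-- Unfolding lemma for `ofFin4`. [folklore] -/
@[simp] theorem ofFin4_apply (F : E → E → E → E → ℝ) (h0 h1 h2 h3) (v : Fin 4 → E) :
    ofFin4 F h0 h1 h2 h3 v = F (v 0) (v 1) (v 2) (v 3) := rfl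

end MultilinearMap

namespace Literature.Geometry.Lorentzian

namespace MetricCoord

/-! ### Multilinear arrays evaluate to the multilinear form -/

section Multilinear

variable {E : Type*} [NormedAddCommGroup E] [NormedSpace ℝ E] {ι : Type*} [Fintype ι] [DecidableEq ι]
  (b : Basis ι ℝ E) {α : Type*} [Fintype α] [DecidableEq α]

omit [DecidableEq ι] in
/-- **Multilinear expansion**: if `T_I = F(b_{I₀}, …)` for a multilinear form `F`, then
`frameComp b T v = F(v)` (O'Neill 1983, Ch. 2, Lemma 2.3 ff.). [cite: ONeill1983, Ch. 2, Lemma 2.3] -/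
theorem frameComp_multilinear (F : MultilinearMap ℝ (fun _ : α ↦ E) ℝ) (v : α → E) :
    frameComp b (fun I ↦ F (b ∘ I)) v = F v := by
  have hv : v = fun a ↦ ∑ i, b.repr (v a) i • b i := funext fun a ↦ (b.sum_repr (v a)).symm
  conv_rhs => rw [hv]
  rw [F.map_sum fun a i ↦ b.repr (v a) i • b i, frameComp_apply]
  refine Finset.sum_congr rfl fun I _ ↦ ?_
  rw [F.map_smul_univ]
  simp only [smul_eq_mul, Basis.coord_apply]
  rfl

omit [DecidableEq ι] in
/-- **A `5`-slot array reduces to its slices**: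
`frameComp b S₀ v = Σ_m bᵐ(v none) · frameComp b (S₀ ∘ ocons m) (v ∘ some)`. [folklore] -/
theorem frameComp_option (S₀ : (Option α → ι) → ℝ) (v : Option α → E) :
    frameComp b S₀ v = ∑ m, b.coord m (v none) * frameComp b (fun I ↦ S₀ (ocons m I)) (v ∘ some) := by
  rw [frameComp_apply, sum_optionIndex]
  refine Finset.sum_congr rfl fun m _ ↦ ?_
  rw [frameComp_apply, Finset.mul_sum]
  refine Finset.sum_congr rfl fun I _ ↦ ?_
  rw [Fintype.prod_option]
  simp only [ocons_none, ocons_some, Function.comp_apply]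
  ring

end Multilinear

/-! ### The volume form on frames -/

section VolForm

variable {E : Type*} [NormedAddCommGroup E] [NormedSpace ℝ E] {ι : Type*} [Fintype ι] [DecidableEq ι]
  {G : E → E →L[ℝ] E →L[ℝ] ℝ} (b : Basis ι ℝ E) {x : E}

/-- `sgnDet I = b.det (b ∘ I)`: the Levi-Civita symbol is the determinant form of the basis on
basis tuples. [folklore] -/
theorem det_basis_comp (I : ι → ι) : b.det (b ∘ I) = sgnDet I := by
  rw [Basis.det_apply, sgnDet, ← Matrix.det_transpose]
  congr 1
  ext a i
  simp only [Matrix.transpose_apply, Basis.toMatrix_apply, Function.comp_apply, Basis.repr_self,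
    Finsupp.single_apply, Matrix.of_apply]

/-- **The volume form is `√det g · b.det`** on basis tuples:
`volForm G b y I = √det g_b(y) · b.det (b ∘ I)`. [cite: ONeill1983, Ch. 7, Def. 7.18] -/
theorem volForm_eq (y : E) (I : ι → ι) : volForm G b y I = sqrtDetGram G b y * b.det (b ∘ I) := by
  rw [volForm_apply, det_basis_comp]

/-- **The volume form evaluated on vectors**: `frameComp b (volForm G b y) v = √det g_b(y) · b.det v`.
[cite: ONeill1983, Ch. 7, Def. 7.18] -/
theorem frameComp_volForm (y : E) (v : ι → E) :
    frameComp b (volForm G b y) v = sqrtDetGram G b y * b.det v := by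
  have h := frameComp_multilinear b (sqrtDetGram G b y • (b.det : MultilinearMap ℝ (fun _ : ι ↦ E) ℝ)) v
  simp only [_root_.smul_apply, AlternatingMap.coe_multilinearMap, smul_eq_mul] at h
  rw [← h]
  congr 1
  funext I
  rw [volForm_eq]

variable (e : Basis ι ℝ E) (he : ∀ i j, G x (e i) (e j) = if i = j then 1 else 0)
include he

/-- In a `G_x`-orthonormal basis `e`: `G(u, w) = Σ_c G(u, e_c) G(w, e_c)` (Parseval).
[cite: ONeill1983, Ch. 2, Lemma 2.25] -/
theorem apply_eq_sum_mul_of_orthonormal (u w : E) : G x u w = ∑ c, G x u (e c) * G x w (e c) := by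
  conv_lhs => rw [← sum_apply_smul_of_orthonormal e he w]
  rw [map_sum]
  exact Finset.sum_congr rfl fun c _ ↦ by rw [map_smul, smul_eq_mul, mul_comm]

/-- **`det g_b = (e.det b)²`** for a `G_x`-orthonormal basis `e`: the Gram matrix of `b` is
`Qᵀ Q` with `Q = (eᶜ(b_i))`. [cite: ONeill1983, Ch. 7, Lemma 7.19] -/
theorem det_gramMatrix_eq_sq : (gramMatrix G b x).det = (e.det b) ^ 2 := by
  have hQ : gramMatrix G b x = (e.toMatrix b)ᵀ * e.toMatrix b := by
    ext i j
    rw [gramMatrix, Matrix.of_apply, apply_eq_sum_mul_of_orthonormal e he, Matrix.mul_apply]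
    refine Finset.sum_congr rfl fun c _ ↦ ?_
    rw [Matrix.transpose_apply, Basis.toMatrix_apply, Basis.toMatrix_apply, ← Basis.coord_apply,
      ← Basis.coord_apply, coord_eq_apply_of_orthonormal e he, coord_eq_apply_of_orthonormal e he]
  rw [hQ, Matrix.det_mul, Matrix.det_transpose, Basis.det_apply, sq]

/-- **On a positively oriented orthonormal basis the volume form is the sign symbol**:
`frameComp b (volForm G b x) (e ∘ K) = sgnDet K` for `e` `G_x`-orthonormal with `0 < b.det e`
(O'Neill 1983, Ch. 7, Lemma 7.19: `ω(e₁, …, eₙ) = 1` on positive orthonormal frames).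
[cite: ONeill1983, Ch. 7, Lemma 7.19] -/
theorem frameComp_volForm_of_orthonormal (hor : 0 < b.det e) (K : ι → ι) : frameComp b (volForm G b x) (e ∘ K) = sgnDet K := by
  rw [frameComp_volForm]
  have h1 : b.det (e ∘ K) = b.det e * e.det (e ∘ K) := by
    have h := AlternatingMap.eq_smul_basis_det e b.det
    have h' := congrArg (fun f : E [⋀^ι]→ₗ[ℝ] ℝ ↦ f (e ∘ K)) h
    simpa only [AlternatingMap.smul_apply, smul_eq_mul] using h'
  have h2 : b.det e * e.det b = 1 := by rw [Basis.det_mul_det, Basis.det_self]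
  have h3 : sqrtDetGram G b x = e.det b := by
    rw [sqrtDetGram, det_gramMatrix_eq_sq b e he, Real.sqrt_sq_eq_abs, abs_of_pos]
    -- `e.det b > 0` since `b.det e > 0` and their product is `1`
    by_contra hle
    push Not at hle
    have : b.det e * e.det b ≤ 0 := mul_nonpos_of_nonneg_of_nonpos hor.le hle
    linarith
  rw [h1, det_basis_comp, h3, ← mul_assoc, mul_comm (e.det b), h2, one_mul]

end VolForm

/-! ### Updating `4`-vectors -/

section Vec4

variable {E : Type*}

/-- `m[0 ↦ z]` for a `4`-vector (a private copy of the lemma of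
`CoordCurvatureDerivatives.lean`, not imported here). [folklore] -/
private theorem updateVec4_zero (a0 a1 a2 a3 z : E) : update ![a0, a1, a2, a3] 0 z = ![z, a1, a2, a3] := by
  funext i; fin_cases i <;> rfl
/-- `m[1 ↦ z]` for a `4`-vector (a private copy of the lemma of
`CoordCurvatureDerivatives.lean`, not imported here). [folklore] -/
private theorem updateVec4_one (a0 a1 a2 a3 z : E) : update ![a0, a1, a2, a3] 1 z = ![a0, z, a2, a3] := by
  funext i; fin_cases i <;> rfl
/-- `m[2 ↦ z]` for a `4`-vector (a private copy of the lemma of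
`CoordCurvatureDerivatives.lean`, not imported here). [folklore] -/
private theorem updateVec4_two (a0 a1 a2 a3 z : E) : update ![a0, a1, a2, a3] 2 z = ![a0, a1, z, a3] := by
  funext i; fin_cases i <;> rfl
/-- `m[3 ↦ z]` for a `4`-vector (a private copy of the lemma of
`CoordCurvatureDerivatives.lean`, not imported here). [folklore] -/
private theorem updateVec4_three (a0 a1 a2 a3 z : E) : update ![a0, a1, a2, a3] 3 z = ![a0, a1, a2, z] := by
  funext i; fin_cases i <;> rfl

end Vec4

/-! ### The Hodge star on frames -/

section StarFrame

variable {E : Type*} [NormedAddCommGroup E] [NormedSpace ℝ E] [FiniteDimensional ℝ E]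
  {G : E → E →L[ℝ] E →L[ℝ] ℝ} (b : Basis (Fin 4) ℝ E) {x : E}

omit [FiniteDimensional ℝ E] in
/-- **Partial multilinear expansion in one slot**: `Σ_p bᵖ(v) F(m[i ↦ b_p]) = F(m[i ↦ v])`. [folklore] -/
theorem sum_coord_mul_apply_update (F : MultilinearMap ℝ (fun _ : Fin 4 ↦ E) ℝ) (m : Fin 4 → E)
    (i : Fin 4) (v : E) : ∑ p, b.coord p v * F (update m i (b p)) = F (update m i v) := by
  conv_rhs => rw [← b.sum_repr v]
  rw [MultilinearMap.map_update_sum]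
  refine Finset.sum_congr rfl fun p _ ↦ ?_
  rw [F.map_update_smul, smul_eq_mul, Basis.coord_apply]

omit [FiniteDimensional ℝ E] in
/-- Composition of the basis with a `4`-tuple of indices. [folklore] -/
theorem basis_comp_vec4 (i0 i1 i2 i3 : Fin 4) : (b ∘ ![i0, i1, i2, i3] : Fin 4 → E) = ![b i0, b i1, b i2, b i3] := by
  funext a; fin_cases a <;> rfl

variable (e : Basis (Fin 4) ℝ E) (he : ∀ i j, G x (e i) (e j) = if i = j then 1 else 0)
include he

/-- **The mixed expansion of `⋆T`**: if `T_I(x) = F(b_I)` for a multilinear `F`, then in terms of a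
`G_x`-orthonormal basis `e`,
`(⋆T)_I(x) = ½ Σ_{c,d} ε(b_{I₀}, b_{I₁}, e_d, e_c) · F(e_d, e_c, b_{I₂}, b_{I₃})` with
`ε = √det g_b · b.det` (`g^{jk} = Σ_c bʲ(e_c) bᵏ(e_c)` and multilinearity). [cite: Besse1987, 1.51] -/
theorem star0_apply_eq_sum_frame (hi : (G x).IsInvertible) (hs : ∀ v w : E, G x v w = G x w v)
    (F : MultilinearMap ℝ (fun _ : Fin 4 ↦ E) ℝ) {T : E → (Fin 4 → Fin 4) → ℝ}
    (hT : ∀ I, T x I = F (b ∘ I)) (I : Fin 4 → Fin 4) :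
    star0 G b T x I = (1 / 2 : ℝ) * ∑ c, ∑ d,
      (sqrtDetGram G b x * b.det ![b (I 0), b (I 1), e d, e c]) * F ![e d, e c, b (I 2), b (I 3)] := by
  set EF : MultilinearMap ℝ (fun _ : Fin 4 ↦ E) ℝ :=
    sqrtDetGram G b x • (b.det : MultilinearMap ℝ (fun _ : Fin 4 ↦ E) ℝ) with hEFdef
  have hEF : ∀ v, EF v = sqrtDetGram G b x * b.det v := fun v ↦ by
    simp only [hEFdef, _root_.smul_apply, AlternatingMap.coe_multilinearMap, smul_eq_mul]
  have hε : ∀ i0 i1 p j, volForm G b x ![i0, i1, p, j] = EF ![b i0, b i1, b p, b j] := by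
    intro i0 i1 p j
    rw [volForm_eq, hEF, basis_comp_vec4]
  have hTb : ∀ q k i2 i3, T x ![q, k, i2, i3] = F ![b q, b k, b i2, b i3] := by
    intro q k i2 i3
    rw [hT, basis_comp_vec4]
  -- one-slot expansions
  have hE2 : ∀ u0 u1 u3 v, ∑ p, b.coord p v * EF ![u0, u1, b p, u3] = EF ![u0, u1, v, u3] := by
    intro u0 u1 u3 v
    have h := sum_coord_mul_apply_update b EF ![u0, u1, u3, u3] 2 v
    simpa only [updateVec4_two] using h
  have hE3 : ∀ u0 u1 u2 v, ∑ j, b.coord j v * EF ![u0, u1, u2, b j] = EF ![u0, u1, u2, v] := by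
    intro u0 u1 u2 v
    have h := sum_coord_mul_apply_update b EF ![u0, u1, u2, u2] 3 v
    simpa only [updateVec4_three] using h
  have hF0 : ∀ u1 u2 u3 v, ∑ q, b.coord q v * F ![b q, u1, u2, u3] = F ![v, u1, u2, u3] := by
    intro u1 u2 u3 v
    have h := sum_coord_mul_apply_update b F ![u1, u1, u2, u3] 0 v
    simpa only [updateVec4_zero] using h
  have hF1 : ∀ u0 u2 u3 v, ∑ k, b.coord k v * F ![u0, b k, u2, u3] = F ![u0, v, u2, u3] := by
    intro u0 u2 u3 v
    have h := sum_coord_mul_apply_update b F ![u0, u0, u2, u3] 1 v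
    simpa only [updateVec4_one] using h
  -- step A: contract `p ~ q` through `e_d`
  have hA : ∀ j k, ∑ p, ∑ q, ginv G b x p q * (volForm G b x ![I 0, I 1, p, j] * T x ![q, k, I 2, I 3]) =
      ∑ d, EF ![b (I 0), b (I 1), e d, b j] * F ![e d, b k, b (I 2), b (I 3)] := by
    intro j k
    simp only [ginv_eq_sum_coord_frame b e he hi hs, hε, hTb, Finset.sum_mul]
    calc ∑ p, ∑ q, ∑ d, b.coord p (e d) * b.coord q (e d) *
          (EF ![b (I 0), b (I 1), b p, b j] * F ![b q, b k, b (I 2), b (I 3)])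
        = ∑ p, ∑ d, ∑ q, b.coord p (e d) * b.coord q (e d) *
          (EF ![b (I 0), b (I 1), b p, b j] * F ![b q, b k, b (I 2), b (I 3)]) :=
          Finset.sum_congr rfl fun p _ ↦ Finset.sum_comm
      _ = ∑ d, ∑ p, ∑ q, b.coord p (e d) * b.coord q (e d) *
          (EF ![b (I 0), b (I 1), b p, b j] * F ![b q, b k, b (I 2), b (I 3)]) := Finset.sum_comm
      _ = ∑ d, (∑ p, b.coord p (e d) * EF ![b (I 0), b (I 1), b p, b j]) *
          (∑ q, b.coord q (e d) * F ![b q, b k, b (I 2), b (I 3)]) := by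
          refine Finset.sum_congr rfl fun d _ ↦ ?_
          rw [Finset.sum_mul_sum]
          exact Finset.sum_congr rfl fun p _ ↦ Finset.sum_congr rfl fun q _ ↦ by ring
      _ = _ := Finset.sum_congr rfl fun d _ ↦ by rw [hE2, hF0]
  -- step B: contract `j ~ k` through `e_c`
  have hB : ∑ j, ∑ k, ginv G b x j k * ∑ d, EF ![b (I 0), b (I 1), e d, b j] * F ![e d, b k, b (I 2), b (I 3)] =
      ∑ c, ∑ d, EF ![b (I 0), b (I 1), e d, e c] * F ![e d, e c, b (I 2), b (I 3)] := by
    have h1 : ∀ j k, ginv G b x j k * ∑ d, EF ![b (I 0), b (I 1), e d, b j] * F ![e d, b k, b (I 2), b (I 3)] =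
        ∑ c, ∑ d, b.coord j (e c) * b.coord k (e c) *
          (EF ![b (I 0), b (I 1), e d, b j] * F ![e d, b k, b (I 2), b (I 3)]) := by
      intro j k
      rw [ginv_eq_sum_coord_frame b e he hi hs, Finset.sum_mul]
      refine Finset.sum_congr rfl fun c _ ↦ ?_
      rw [Finset.mul_sum]
    simp only [h1]
    have h2 : ∑ j, ∑ k, ∑ c, ∑ d, b.coord j (e c) * b.coord k (e c) *
          (EF ![b (I 0), b (I 1), e d, b j] * F ![e d, b k, b (I 2), b (I 3)]) =
        ∑ c, ∑ d, ∑ j, ∑ k, b.coord j (e c) * b.coord k (e c) *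
          (EF ![b (I 0), b (I 1), e d, b j] * F ![e d, b k, b (I 2), b (I 3)]) := by
      calc ∑ j, ∑ k, ∑ c, ∑ d, b.coord j (e c) * b.coord k (e c) *
              (EF ![b (I 0), b (I 1), e d, b j] * F ![e d, b k, b (I 2), b (I 3)])
          = ∑ j, ∑ c, ∑ k, ∑ d, b.coord j (e c) * b.coord k (e c) *
              (EF ![b (I 0), b (I 1), e d, b j] * F ![e d, b k, b (I 2), b (I 3)]) :=
            Finset.sum_congr rfl fun _ _ ↦ Finset.sum_comm
        _ = ∑ c, ∑ j, ∑ k, ∑ d, b.coord j (e c) * b.coord k (e c) *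
              (EF ![b (I 0), b (I 1), e d, b j] * F ![e d, b k, b (I 2), b (I 3)]) := Finset.sum_comm
        _ = ∑ c, ∑ j, ∑ d, ∑ k, b.coord j (e c) * b.coord k (e c) *
              (EF ![b (I 0), b (I 1), e d, b j] * F ![e d, b k, b (I 2), b (I 3)]) :=
            Finset.sum_congr rfl fun _ _ ↦ Finset.sum_congr rfl fun _ _ ↦ Finset.sum_comm
        _ = ∑ c, ∑ d, ∑ j, ∑ k, b.coord j (e c) * b.coord k (e c) *
              (EF ![b (I 0), b (I 1), e d, b j] * F ![e d, b k, b (I 2), b (I 3)]) :=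
            Finset.sum_congr rfl fun _ _ ↦ Finset.sum_comm
    rw [h2]
    refine Finset.sum_congr rfl fun c _ ↦ Finset.sum_congr rfl fun d _ ↦ ?_
    have h3 : ∑ j, ∑ k, b.coord j (e c) * b.coord k (e c) *
          (EF ![b (I 0), b (I 1), e d, b j] * F ![e d, b k, b (I 2), b (I 3)]) =
        (∑ j, b.coord j (e c) * EF ![b (I 0), b (I 1), e d, b j]) *
          (∑ k, b.coord k (e c) * F ![e d, b k, b (I 2), b (I 3)]) := by
      rw [Finset.sum_mul_sum]
      exact Finset.sum_congr rfl fun j _ ↦ Finset.sum_congr rfl fun k _ ↦ by ring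
    rw [h3, hE3, hF1]
  rw [star0_apply]
  simp only [hA]
  rw [hB]
  simp only [hEF]

/-- **The Hodge star on a positively oriented orthonormal frame**: if `T_I(x) = F(b_I)` for a
multilinear `F` and `e` is a `G_x`-orthonormal basis with `0 < b.det e`, then
`frameComp b (⋆T(x)) (e ∘ K) = ½ Σ_{d,c} sgnDet(K₀,K₁,d,c) · F(e_d, e_c, e_{K₂}, e_{K₃})` — the
orthonormal-frame formula `(⋆T)_{ijkl} = ½ ε_{ijab} T_{abkl}`. [cite: Besse1987, 1.51]
[cite: GurskyLebrun1999, §2, (deco)] -/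
theorem frameComp_star0_of_orthonormal (hi : (G x).IsInvertible) (hs : ∀ v w : E, G x v w = G x w v)
    (hor : 0 < b.det e) (F : MultilinearMap ℝ (fun _ : Fin 4 ↦ E) ℝ) {T : E → (Fin 4 → Fin 4) → ℝ}
    (hT : ∀ I, T x I = F (b ∘ I)) (K : Fin 4 → Fin 4) :
    frameComp b (star0 G b T x) (e ∘ K) =
      (1 / 2 : ℝ) * ∑ c, ∑ d, sgnDet ![K 0, K 1, d, c] * F (e ∘ ![d, c, K 2, K 3]) := by
  -- the array `I ↦ (⋆T)_I(x)` is the multilinear form `M(u) = ½ Σ ε(u₀,u₁,e_d,e_c) F(e_d,e_c,u₂,u₃)`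
  set EF : MultilinearMap ℝ (fun _ : Fin 4 ↦ E) ℝ :=
    sqrtDetGram G b x • (b.det : MultilinearMap ℝ (fun _ : Fin 4 ↦ E) ℝ) with hEFdef
  have hEF : ∀ v, EF v = sqrtDetGram G b x * b.det v := fun v ↦ by
    simp only [hEFdef, _root_.smul_apply, AlternatingMap.coe_multilinearMap, smul_eq_mul]
  have hlin0 : ∀ (Φ : MultilinearMap ℝ (fun _ : Fin 4 ↦ E) ℝ) (u1 u2 u3 : E),
      IsLinearMap ℝ fun u ↦ Φ ![u, u1, u2, u3] := fun Φ u1 u2 u3 ↦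
    { map_add := fun u u' ↦ by
        have h := Φ.map_update_add ![u, u1, u2, u3] 0 u u'
        simpa only [updateVec4_zero] using h
      map_smul := fun c u ↦ by
        have h := Φ.map_update_smul ![u, u1, u2, u3] 0 c u
        simpa only [updateVec4_zero] using h }
  have hlin1 : ∀ (Φ : MultilinearMap ℝ (fun _ : Fin 4 ↦ E) ℝ) (u0 u2 u3 : E),
      IsLinearMap ℝ fun u ↦ Φ ![u0, u, u2, u3] := fun Φ u0 u2 u3 ↦
    { map_add := fun u u' ↦ by
        have h := Φ.map_update_add ![u0, u, u2, u3] 1 u u'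
        simpa only [updateVec4_one] using h
      map_smul := fun c u ↦ by
        have h := Φ.map_update_smul ![u0, u, u2, u3] 1 c u
        simpa only [updateVec4_one] using h }
  have hlin2 : ∀ (Φ : MultilinearMap ℝ (fun _ : Fin 4 ↦ E) ℝ) (u0 u1 u3 : E),
      IsLinearMap ℝ fun u ↦ Φ ![u0, u1, u, u3] := fun Φ u0 u1 u3 ↦
    { map_add := fun u u' ↦ by
        have h := Φ.map_update_add ![u0, u1, u, u3] 2 u u'
        simpa only [updateVec4_two] using h
      map_smul := fun c u ↦ by
        have h := Φ.map_update_smul ![u0, u1, u, u3] 2 c u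
        simpa only [updateVec4_two] using h }
  have hlin3 : ∀ (Φ : MultilinearMap ℝ (fun _ : Fin 4 ↦ E) ℝ) (u0 u1 u2 : E),
      IsLinearMap ℝ fun u ↦ Φ ![u0, u1, u2, u] := fun Φ u0 u1 u2 ↦
    { map_add := fun u u' ↦ by
        have h := Φ.map_update_add ![u0, u1, u2, u] 3 u u'
        simpa only [updateVec4_three] using h
      map_smul := fun c u ↦ by
        have h := Φ.map_update_smul ![u0, u1, u2, u] 3 c u
        simpa only [updateVec4_three] using h }
  let M : MultilinearMap ℝ (fun _ : Fin 4 ↦ E) ℝ := MultilinearMap.ofFin4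
    (fun u0 u1 u2 u3 ↦ (1 / 2 : ℝ) * ∑ c, ∑ d, EF ![u0, u1, e d, e c] * F ![e d, e c, u2, u3])
    (fun u1 u2 u3 ↦ by
      refine ⟨fun u u' ↦ ?_, fun a u ↦ ?_⟩
      · simp only [(hlin0 EF _ _ _).map_add, add_mul, Finset.sum_add_distrib, mul_add]
      · simp only [(hlin0 EF _ _ _).map_smul, smul_eq_mul, Finset.mul_sum]
        exact Finset.sum_congr rfl fun _ _ ↦ Finset.sum_congr rfl fun _ _ ↦ by ring)
    (fun u0 u2 u3 ↦ by
      refine ⟨fun u u' ↦ ?_, fun a u ↦ ?_⟩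
      · simp only [(hlin1 EF _ _ _).map_add, add_mul, Finset.sum_add_distrib, mul_add]
      · simp only [(hlin1 EF _ _ _).map_smul, smul_eq_mul, Finset.mul_sum]
        exact Finset.sum_congr rfl fun _ _ ↦ Finset.sum_congr rfl fun _ _ ↦ by ring)
    (fun u0 u1 u3 ↦ by
      refine ⟨fun u u' ↦ ?_, fun a u ↦ ?_⟩
      · simp only [(hlin2 F _ _ _).map_add, mul_add, Finset.sum_add_distrib]
      · simp only [(hlin2 F _ _ _).map_smul, smul_eq_mul, Finset.mul_sum]
        exact Finset.sum_congr rfl fun _ _ ↦ Finset.sum_congr rfl fun _ _ ↦ by ring)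
    (fun u0 u1 u2 ↦ by
      refine ⟨fun u u' ↦ ?_, fun a u ↦ ?_⟩
      · simp only [(hlin3 F _ _ _).map_add, mul_add, Finset.sum_add_distrib]
      · simp only [(hlin3 F _ _ _).map_smul, smul_eq_mul, Finset.mul_sum]
        exact Finset.sum_congr rfl fun _ _ ↦ Finset.sum_congr rfl fun _ _ ↦ by ring)
  have hM : ∀ I : Fin 4 → Fin 4, star0 G b T x I = M (b ∘ I) := by
    intro I
    rw [star0_apply_eq_sum_frame b e he hi hs F hT I]
    simp only [M, MultilinearMap.ofFin4_apply, Function.comp_apply, hEF]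
  have hfc : frameComp b (star0 G b T x) (e ∘ K) = M (e ∘ K) := by
    rw [show star0 G b T x = fun I ↦ M (b ∘ I) from funext hM]
    exact frameComp_multilinear b M (e ∘ K)
  rw [hfc]
  simp only [M, MultilinearMap.ofFin4_apply, Function.comp_apply, hEF]
  congr 1
  refine Finset.sum_congr rfl fun c _ ↦ Finset.sum_congr rfl fun d _ ↦ ?_
  have h1 : (![e (K 0), e (K 1), e d, e c] : Fin 4 → E) = e ∘ ![K 0, K 1, d, c] := by
    funext a; fin_cases a <;> rfl
  have h2 : (![e d, e c, e (K 2), e (K 3)] : Fin 4 → E) = e ∘ ![d, c, K 2, K 3] := by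
    funext a; fin_cases a <;> rfl
  rw [h1, h2, ← frameComp_volForm, frameComp_volForm_of_orthonormal b e he hor]

end StarFrame

end MetricCoord

end Literature.Geometry.Lorentzian

end
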